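import Summits.Ventures.PercRepro.K5MatroidDefs

/-!
# PercRepro — `M(K₅)`: union-find computes the rank, the sets with at most five edges (p9, gen 15; local draft)

`rkG X = rk X` on the edge sets with 0 … 5 edges (one kernel decision per size: the 1024-element traversal with the
rank computed on the matching sets only — one theorem for all 1024 sets exceeds the kernel's per-declaration budget).
Nothing here is about any window of S4.
-/

namespace PercRepro.K5Ladder

open Finset

set_option maxHeartbeats 4000000 in
/-- Union-find computes the matroid rank on the edge sets with `0` edges (`C(10,0)` kernel evaluations of both). -/
theorem rkG_eq_rk_0 : ∀ X : Finset (Fin 10), X.card = 0 → rkG X = rk X := by decide +kernel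

set_option maxHeartbeats 4000000 in
/-- Union-find computes the matroid rank on the edge sets with `1` edges (`C(10,1)` kernel evaluations of both). -/
theorem rkG_eq_rk_1 : ∀ X : Finset (Fin 10), X.card = 1 → rkG X = rk X := by decide +kernel

set_option maxHeartbeats 4000000 in
/-- Union-find computes the matroid rank on the edge sets with `2` edges (`C(10,2)` kernel evaluations of both). -/
theorem rkG_eq_rk_2 : ∀ X : Finset (Fin 10), X.card = 2 → rkG X = rk X := by decide +kernel

set_option maxHeartbeats 4000000 in
/-- Union-find computes the matroid rank on the edge sets with `3` edges (`C(10,3)` kernel evaluations of both). -/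
theorem rkG_eq_rk_3 : ∀ X : Finset (Fin 10), X.card = 3 → rkG X = rk X := by decide +kernel

set_option maxHeartbeats 4000000 in
/-- Union-find computes the matroid rank on the edge sets with `4` edges (`C(10,4)` kernel evaluations of both). -/
theorem rkG_eq_rk_4 : ∀ X : Finset (Fin 10), X.card = 4 → rkG X = rk X := by decide +kernel

set_option maxHeartbeats 4000000 in
/-- Union-find computes the matroid rank on the edge sets with `5` edges (`C(10,5)` kernel evaluations of both). -/
theorem rkG_eq_rk_5 : ∀ X : Finset (Fin 10), X.card = 5 → rkG X = rk X := by decide +kernel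

end PercRepro.K5Ladder
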